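import Literature.Barriers.Parity.SiegelZeroPrimePairsRoughSums
import Literature.NumberTheory.Sieve.RoughDivisorPowerSums
import Mathlib.NumberTheory.ArithmeticFunction.Liouville
import HarnessLib

/-!
# Matomäki–Merikoski Lemma 2.4, preparation: from `χ` to the Liouville function on rough numbers (§6, first two steps)

Sibling of `Literature/Barriers/Parity/SiegelZeroPrimePairsRoughSums.lean` (Lemma 2.2 of Matomäki–Merikoski,
arXiv:2112.11412). Everything in this file is PROVED. It formalises the first two reductions of §6
(proof of Lemma 2.4) for the sum `∑_{n ≤ N, (n, P(z)) = 1} χ(n) w(n)` with a weight `|w(n)| ≤ W/n`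
(in the source `w(n) = log(y/n)/n`, `W ≍ log X`):

* "We first replace `χ(n)` by `μ(n)` in the sum. We have `χ = λ ∗ μ`, `χ(n) = μ(n) + ∑_{n = km, m > 1} μ(k)λ(m)`,
  so that `∑_{n ≤ N, (n,P(z))=1} χ(n) w(n) = ∑_{(n,P(z))=1} μ(n) w(n) + ∑_{km ≤ N, (km,P(z))=1, m ≥ z} μ(k)λ(m) w(km)`"
  and the second term is `≤ W ∑_{k ≤ N, (k,P(z))=1} 1/k · ∑_{z ≤ m ≤ N, (m,P(z))=1} λ(m)/m` in absolute value
  (`MatomakiMerikoski.abs_sum_rough_chi_sub_sum_rough_moebius_le`; the two factors are then bounded by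
  `RoughSums.exists_sum_rough_sigma_zero_pow_div_le 0` and Lemma 2.2, `MatomakiMerikoski2023_lemma22`);
* "`μ(n) = λ_L(n)` unless `n` is not square-free": on rough numbers
  `|∑ μ(n) w(n) − ∑ λ_L(n) w(n)| ≤ W ∑_{z ≤ p ≤ √N} p⁻² ∑_{n' ≤ N/p², (n',P(z))=1} 1/n'`
  (`MatomakiMerikoski.abs_sum_rough_moebius_sub_sum_rough_liouville_le`), "`≪ (u log X)/z`" by the same tools.

Here `λ = 1 ∗ χ` is Mathlib's `χ.zetaMul` (real part; real and `≥ 0` for quadratic `χ`), `λ_L` is Mathlib's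
`ArithmeticFunction.liouville`, and "`(n, P(z)) = 1`" is written as the filter "all prime factors `≥ z`" of
`SiegelZeroPrimePairsRoughSums.lean`.

## References

* K. Matomäki, J. Merikoski, IMRN 2023 (arXiv:2112.11412), §6 (proof of Lemma 2.4), first three displays.
  [cite: MatomakiMerikoski2023, §6]
-/

noncomputable section

open Finset Real ArithmeticFunction
open scoped ArithmeticFunction.Moebius ArithmeticFunction.zeta

namespace Literature.Barriers.Parity.MatomakiMerikoski

variable {q : ℕ} (χ : DirichletCharacter ℂ q)

/-! ### `χ = μ ∗ λ` -/

/-- **`χ = μ ∗ λ`** (`λ = 1 ∗ χ`): as arithmetic functions, `μ * χ.zetaMul = χ` (Möbius inversion,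
`μ * ζ = 1`). [folklore] -/
theorem moebius_mul_zetaMul :
    (μ : ArithmeticFunction ℂ) * χ.zetaMul = toArithmeticFunction (χ ·) := by
  rw [DirichletCharacter.zetaMul, ← mul_assoc, coe_moebius_mul_coe_zeta, one_mul]

/-- `χ(n) = ∑_{km = n} μ(k) λ(m)` for `n ≠ 0`. [folklore] -/
theorem apply_eq_sum_moebius_mul_zetaMul {n : ℕ} (hn : n ≠ 0) :
    χ n = ∑ x ∈ n.divisorsAntidiagonal, (μ x.1 : ℂ) * χ.zetaMul x.2 := by
  have h := congrArg (fun f : ArithmeticFunction ℂ => f n) (moebius_mul_zetaMul χ)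
  simp only [mul_apply, toArithmeticFunction, coe_mk, if_neg hn, intCoe_apply] at h
  exact h.symm

/-- Real parts: `Re χ(n) = ∑_{km = n} μ(k) Re λ(m)` for `n ≠ 0`. [folklore] -/
theorem re_apply_eq_sum {n : ℕ} (hn : n ≠ 0) :
    (χ n).re = ∑ x ∈ n.divisorsAntidiagonal, (μ x.1 : ℝ) * (χ.zetaMul x.2).re := by
  rw [apply_eq_sum_moebius_mul_zetaMul χ hn, Complex.re_sum]
  refine Finset.sum_congr rfl fun x _ => ?_
  rw [Complex.mul_re]
  simp [Complex.intCast_re, Complex.intCast_im]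

/-! ### Rough numbers: divisors of rough numbers are rough -/

/-- If all prime factors of `n` are `≥ z` and `k ∣ n`, `n ≠ 0`, then all prime factors of `k` are `≥ z`.
[folklore] -/
theorem rough_of_dvd {z : ℝ} {n k : ℕ} (hn : n ≠ 0) (hk : k ∣ n)
    (h : ∀ p ∈ n.primeFactors, z ≤ ((p : ℕ) : ℝ)) : ∀ p ∈ k.primeFactors, z ≤ ((p : ℕ) : ℝ) :=
  fun p hp => h p (Nat.primeFactors_mono hk hn hp)

/-- A rough number `m > 1` is `≥ z`: it has a prime factor, which is `≥ z`. [folklore] -/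
theorem le_of_rough_of_one_lt {z : ℝ} {m : ℕ} (hm : 1 < m)
    (h : ∀ p ∈ m.primeFactors, z ≤ ((p : ℕ) : ℝ)) : z ≤ (m : ℝ) := by
  have hp := Nat.minFac_prime hm.ne'
  have hmem : m.minFac ∈ m.primeFactors :=
    Nat.mem_primeFactors.mpr ⟨hp, Nat.minFac_dvd m, by omega⟩
  exact (h _ hmem).trans (by exact_mod_cast Nat.minFac_le (by omega))

/-! ### Step 1: `χ → μ` on rough numbers -/

/-- **Replacing `χ` by `μ` on rough numbers** (§6, first step): for quadratic `χ`, `N : ℕ`, real `z`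
and a weight with `|w(n)| ≤ W/n` on `1 ≤ n ≤ N`,
`|∑_{n ≤ N rough} Re χ(n) w(n) − ∑_{n ≤ N rough} μ(n) w(n)| ≤ W (∑_{k ≤ N rough} 1/k)(∑_{z ≤ m ≤ N rough} λ(m)/m)`
("rough" = all prime factors `≥ z`; `λ = Re χ.zetaMul ≥ 0`).
[cite: MatomakiMerikoski2023, §6 (first and second displays)] -/
theorem abs_sum_rough_chi_sub_sum_rough_moebius_le (hχ : χ ^ 2 = 1) (N : ℕ) (z : ℝ)
    {w : ℕ → ℝ} {W : ℝ} (hW0 : 0 ≤ W) (hw : ∀ n ∈ Icc 1 N, |w n| ≤ W / n) :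
    |∑ n ∈ (Icc 1 N).filter (fun n => ∀ p ∈ n.primeFactors, z ≤ ((p : ℕ) : ℝ)), (χ n).re * w n -
        ∑ n ∈ (Icc 1 N).filter (fun n => ∀ p ∈ n.primeFactors, z ≤ ((p : ℕ) : ℝ)), (μ n : ℝ) * w n| ≤
      W * (∑ k ∈ (Icc 1 N).filter (fun n => ∀ p ∈ n.primeFactors, z ≤ ((p : ℕ) : ℝ)), (k : ℝ)⁻¹) *
        ∑ m ∈ (Icc ⌈z⌉₊ N).filter (fun n => ∀ p ∈ n.primeFactors, z ≤ ((p : ℕ) : ℝ)),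
          (χ.zetaMul m).re / m := by
  classical
  set R : Finset ℕ := (Icc 1 N).filter (fun n => ∀ p ∈ n.primeFactors, z ≤ ((p : ℕ) : ℝ)) with hR
  set Rz : Finset ℕ := (Icc ⌈z⌉₊ N).filter (fun n => ∀ p ∈ n.primeFactors, z ≤ ((p : ℕ) : ℝ)) with hRz
  have hlam0 : ∀ m, 0 ≤ (χ.zetaMul m).re := Literature.NumberTheory.LFunctions.SmoothEulerProduct.zetaMul_re_nonneg χ hχ
  have hlam1 : (χ.zetaMul 1).re = 1 := Literature.NumberTheory.LFunctions.SmoothEulerProduct.zetaMul_one_re χ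
  -- the difference, termwise: `Re χ(n) − μ(n) = ∑_{km = n, m ≠ 1} μ(k) λ(m)`
  have hdiff : ∀ n ∈ R, (χ n).re * w n - (μ n : ℝ) * w n =
      ∑ x ∈ n.divisorsAntidiagonal.filter (fun x => x.2 ≠ 1), (μ x.1 : ℝ) * (χ.zetaMul x.2).re * w n := by
    intro n hn
    have hn1 : 1 ≤ n := (mem_Icc.mp (mem_filter.mp hn).1).1
    have hn0 : n ≠ 0 := by omega
    rw [re_apply_eq_sum χ hn0, ← Finset.sum_filter_add_sum_filter_not n.divisorsAntidiagonal (fun x => x.2 ≠ 1)]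
    have hone : ∑ x ∈ n.divisorsAntidiagonal.filter (fun x => ¬ x.2 ≠ 1), (μ x.1 : ℝ) * (χ.zetaMul x.2).re =
        (μ n : ℝ) := by
      have hset : n.divisorsAntidiagonal.filter (fun x => ¬ x.2 ≠ 1) = {(n, 1)} := by
        ext x
        simp only [mem_filter, Nat.mem_divisorsAntidiagonal, not_not, mem_singleton]
        constructor
        · rintro ⟨⟨hx, -⟩, h2⟩
          rw [h2, mul_one] at hx
          exact Prod.ext hx h2
        · rintro rfl
          exact ⟨⟨mul_one n, hn0⟩, rfl⟩
      rw [hset, sum_singleton, hlam1, mul_one]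
    rw [hone, add_mul, Finset.sum_mul]
    ring
  rw [← Finset.sum_sub_distrib, Finset.sum_congr rfl hdiff]
  -- bound termwise and rearrange to the pairs `(k, m)`, `k ∈ R`, `m ∈ Rz`
  have hterm : ∀ n ∈ R, |∑ x ∈ n.divisorsAntidiagonal.filter (fun x => x.2 ≠ 1),
      (μ x.1 : ℝ) * (χ.zetaMul x.2).re * w n| ≤
      ∑ x ∈ n.divisorsAntidiagonal.filter (fun x => x.2 ≠ 1), W * ((x.1 : ℝ)⁻¹ * ((χ.zetaMul x.2).re / x.2)) := by
    intro n hn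
    have hn' := mem_filter.mp hn
    have hn1 : 1 ≤ n := (mem_Icc.mp hn'.1).1
    have hwn := hw n hn'.1
    refine (abs_sum_le_sum_abs _ _).trans (Finset.sum_le_sum fun x hx => ?_)
    have hx' := (mem_filter.mp hx).1
    rw [Nat.mem_divisorsAntidiagonal] at hx'
    have hk0 : (0 : ℝ) < x.1 := by
      have := left_ne_zero_of_mul (hx'.1.symm ▸ hx'.2); exact_mod_cast Nat.pos_of_ne_zero this
    have hm0 : (0 : ℝ) < x.2 := by
      have := right_ne_zero_of_mul (hx'.1.symm ▸ hx'.2); exact_mod_cast Nat.pos_of_ne_zero this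
    have hμ : |(μ x.1 : ℝ)| ≤ 1 := by exact_mod_cast ArithmeticFunction.abs_moebius_le_one
    rw [abs_mul, abs_mul, abs_of_nonneg (hlam0 _)]
    calc |(μ x.1 : ℝ)| * (χ.zetaMul x.2).re * |w n| ≤ 1 * (χ.zetaMul x.2).re * (W / n) :=
          mul_le_mul (mul_le_mul_of_nonneg_right hμ (hlam0 _)) hwn (abs_nonneg _)
            (by rw [one_mul]; exact hlam0 _)
      _ = W * ((x.1 : ℝ)⁻¹ * ((χ.zetaMul x.2).re / x.2)) := by
          rw [← hx'.1, Nat.cast_mul]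
          field_simp
  refine (abs_sum_le_sum_abs _ _).trans ((Finset.sum_le_sum hterm).trans ?_)
  -- the pair map `(n, (k, m)) ↦ (k, m)` is injective on the sigma set and lands in `R ×ˢ Rz`
  set H : ℕ × ℕ → ℝ := fun x => W * ((x.1 : ℝ)⁻¹ * ((χ.zetaMul x.2).re / x.2)) with hH
  have hH0 : ∀ x, 0 ≤ H x := fun x => by
    rw [hH]; exact mul_nonneg hW0 (mul_nonneg (inv_nonneg.mpr (Nat.cast_nonneg _))
      (div_nonneg (hlam0 _) (Nat.cast_nonneg _)))
  have hRHS : W * (∑ k ∈ R, (k : ℝ)⁻¹) * ∑ m ∈ Rz, (χ.zetaMul m).re / m = ∑ x ∈ R ×ˢ Rz, H x := by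
    rw [Finset.sum_product, Finset.mul_sum]
    simp_rw [Finset.mul_sum, Finset.sum_mul]
    rw [Finset.sum_comm]
    refine Finset.sum_congr rfl fun k _ => Finset.sum_congr rfl fun m _ => ?_
    simp only [hH]
    ring
  rw [hRHS, ← Finset.sum_sigma R (fun n => n.divisorsAntidiagonal.filter (fun x => x.2 ≠ 1))
    (fun y => H y.2)]
  -- injectivity of `y ↦ y.2` on the sigma set
  have hinj : Set.InjOn (fun y : (Σ _ : ℕ, ℕ × ℕ) => y.2)
      ↑(R.sigma fun n => n.divisorsAntidiagonal.filter (fun x => x.2 ≠ 1)) := by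
    rintro ⟨n₁, x₁⟩ h₁ ⟨n₂, x₂⟩ h₂ heq
    simp only [Finset.coe_sigma, Set.mem_sigma_iff, Finset.mem_coe, mem_filter,
      Nat.mem_divisorsAntidiagonal] at h₁ h₂
    simp only at heq
    subst heq
    have : n₁ = n₂ := by rw [← h₁.2.1.1, ← h₂.2.1.1]
    subst this
    rfl
  rw [← Finset.sum_image (f := H) hinj]
  refine Finset.sum_le_sum_of_subset_of_nonneg ?_ fun x _ _ => hH0 x
  intro x hx
  rw [Finset.mem_image] at hx
  obtain ⟨⟨n, y⟩, hy, hxy⟩ := hx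
  rw [← hxy]
  simp only [Finset.mem_sigma, mem_filter, Nat.mem_divisorsAntidiagonal] at hy
  obtain ⟨hnR, ⟨hkm, hn0⟩, hm1⟩ := hy
  have hnR' : n ∈ Icc 1 N ∧ ∀ p ∈ n.primeFactors, z ≤ ((p : ℕ) : ℝ) := by
    simpa only [hR, mem_filter] using hnR
  obtain ⟨hnI, hnr⟩ := hnR'
  have hk : y.1 ∣ n := ⟨y.2, hkm.symm⟩
  have hm : y.2 ∣ n := ⟨y.1, by rw [mul_comm]; exact hkm.symm⟩
  have hk0 : y.1 ≠ 0 := left_ne_zero_of_mul (hkm.symm ▸ hn0)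
  have hm0 : y.2 ≠ 0 := right_ne_zero_of_mul (hkm.symm ▸ hn0)
  have hnN : n ≤ N := (mem_Icc.mp hnI).2
  rw [Finset.mem_product]
  constructor
  · rw [hR, mem_filter, mem_Icc]
    exact ⟨⟨Nat.one_le_iff_ne_zero.mpr hk0, (Nat.le_of_dvd (Nat.pos_of_ne_zero hn0) hk).trans hnN⟩,
      rough_of_dvd hn0 hk hnr⟩
  · rw [hRz, mem_filter, mem_Icc]
    have hmr := rough_of_dvd hn0 hm hnr
    have hm1' : 1 < y.2 := by omega
    refine ⟨⟨Nat.ceil_le.mpr (le_of_rough_of_one_lt hm1' hmr),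
      (Nat.le_of_dvd (Nat.pos_of_ne_zero hn0) hm).trans hnN⟩, hmr⟩

/-! ### Step 2: `μ → λ_L` on rough numbers -/

/-- `μ(n) = λ_L(n)` for squarefree `n`, `μ(n) = 0` otherwise. [folklore] -/
theorem moebius_sub_liouville_eq (n : ℕ) :
    (μ n : ℝ) - (liouville n : ℝ) = if Squarefree n then 0 else -(liouville n : ℝ) := by
  split_ifs with h
  · rw [ArithmeticFunction.moebius_apply_of_squarefree h, ArithmeticFunction.liouville_apply h.ne_zero]
    simp
  · rw [ArithmeticFunction.moebius_eq_zero_of_not_squarefree h]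
    simp

/-- **Replacing `μ` by `λ_L` on rough numbers** (§6, "`μ(n) = λ_L(n)` unless `n` is not square-free"):
for `N : ℕ`, real `z > 1` and a weight with `|w(n)| ≤ W/n` on `1 ≤ n ≤ N`,
`|∑_{n ≤ N rough} μ(n) w(n) − ∑_{n ≤ N rough} λ_L(n) w(n)| ≤ W ∑_{z ≤ p ≤ N prime} p⁻² ∑_{n' ≤ N/p² rough} 1/n'`
(a non-square-free rough `n` is `p² n'` with `p ≥ z` prime — its least square factor — and `n'` rough).
[cite: MatomakiMerikoski2023, §6 (third display)] -/
theorem abs_sum_rough_moebius_sub_sum_rough_liouville_le (N : ℕ) (z : ℝ)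
    {w : ℕ → ℝ} {W : ℝ} (hW0 : 0 ≤ W) (hw : ∀ n ∈ Icc 1 N, |w n| ≤ W / n) :
    |∑ n ∈ (Icc 1 N).filter (fun n => ∀ p ∈ n.primeFactors, z ≤ ((p : ℕ) : ℝ)), (μ n : ℝ) * w n -
        ∑ n ∈ (Icc 1 N).filter (fun n => ∀ p ∈ n.primeFactors, z ≤ ((p : ℕ) : ℝ)), (liouville n : ℝ) * w n| ≤
      W * ∑ p ∈ (Icc ⌈z⌉₊ N).filter Nat.Prime, ((p : ℝ) ^ 2)⁻¹ *
        ∑ m ∈ (Icc 1 (N / p ^ 2)).filter (fun n => ∀ p ∈ n.primeFactors, z ≤ ((p : ℕ) : ℝ)), (m : ℝ)⁻¹ := by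
  classical
  set R : Finset ℕ := (Icc 1 N).filter (fun n => ∀ p ∈ n.primeFactors, z ≤ ((p : ℕ) : ℝ)) with hR
  set Rof : ℕ → Finset ℕ := fun M => (Icc 1 M).filter (fun n => ∀ p ∈ n.primeFactors, z ≤ ((p : ℕ) : ℝ))
    with hRof
  set P : Finset ℕ := (Icc ⌈z⌉₊ N).filter Nat.Prime with hP
  -- the difference lives on the non-square-free `n ∈ R`
  have hdiff : ∑ n ∈ R, (μ n : ℝ) * w n - ∑ n ∈ R, (liouville n : ℝ) * w n =
      ∑ n ∈ R.filter (fun n => ¬ Squarefree n), -(liouville n : ℝ) * w n := by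
    have hpt : ∀ n ∈ R, (μ n : ℝ) * w n - (liouville n : ℝ) * w n =
        if ¬ Squarefree n then -(liouville n : ℝ) * w n else 0 := by
      intro n _
      rw [← sub_mul, moebius_sub_liouville_eq]
      split_ifs <;> simp
    rw [← Finset.sum_sub_distrib, Finset.sum_congr rfl hpt, ← Finset.sum_filter]
  rw [hdiff]
  -- termwise bound `W/n`
  have hterm : ∀ n ∈ R.filter (fun n => ¬ Squarefree n), |-(liouville n : ℝ) * w n| ≤ W / n := by
    intro n hn
    have hn' := (mem_filter.mp (mem_filter.mp hn).1).1
    have hn1 : (1 : ℝ) ≤ n := by exact_mod_cast (mem_Icc.mp hn').1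
    rw [abs_mul, abs_neg]
    -- `|λ_L(n)| ≤ 1` (the tree's `LiouvilleSum.abs_liouville_le_one`, inlined to keep the imports light)
    have hliou : |(liouville n : ℝ)| ≤ 1 := by
      rcases eq_or_ne n 0 with rfl | hn0
      · simp
      · rw [ArithmeticFunction.liouville_apply hn0]; simp
    calc |(liouville n : ℝ)| * |w n| ≤ 1 * (W / n) :=
          mul_le_mul hliou (hw n hn') (abs_nonneg _) zero_le_one
      _ = W / n := one_mul _
  refine (abs_sum_le_sum_abs _ _).trans ((Finset.sum_le_sum hterm).trans ?_)
  -- the map `n ↦ (p, n/p²)`, `p` the least prime with `p² ∣ n`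
  set e : ℕ → (Σ _ : ℕ, ℕ) := fun n => ⟨n.minSqFac.getD 0, n / (n.minSqFac.getD 0 * n.minSqFac.getD 0)⟩
    with he
  set G : (Σ _ : ℕ, ℕ) → ℝ := fun y => W * (((y.1 : ℝ) ^ 2)⁻¹ * (y.2 : ℝ)⁻¹) with hG
  have hG0 : ∀ y, 0 ≤ G y := fun y => by rw [hG]; positivity
  -- facts about `e n` for non-square-free `n ∈ R`
  have hfacts : ∀ n ∈ R.filter (fun n => ¬ Squarefree n),
      (e n).1.Prime ∧ (e n).1 * (e n).1 * (e n).2 = n ∧ z ≤ ((e n).1 : ℝ) ∧ (e n).2 ∈ Rof (N / (e n).1 ^ 2) ∧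
        (e n).1 ∈ P := by
    intro n hn
    obtain ⟨hnR, hnsq⟩ := mem_filter.mp hn
    have hnR' : n ∈ Icc 1 N ∧ ∀ p ∈ n.primeFactors, z ≤ ((p : ℕ) : ℝ) := by
      simpa only [hR, mem_filter] using hnR
    obtain ⟨hnI, hnr⟩ := hnR'
    obtain ⟨hn1, hnN⟩ := mem_Icc.mp hnI
    have hn0 : n ≠ 0 := by omega
    have hsome : ∃ d, n.minSqFac = some d := by
      rcases h : n.minSqFac with _ | d
      · exact absurd (Nat.squarefree_iff_minSqFac.mpr h) hnsq
      · exact ⟨d, rfl⟩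
    obtain ⟨d, hd⟩ := hsome
    have hdp : d.Prime := Nat.minSqFac_prime hd
    have hdd : d * d ∣ n := Nat.minSqFac_dvd hd
    have he1 : (e n).1 = d := by simp [he, hd]
    have he2 : (e n).2 = n / (d * d) := by simp [he, hd]
    have hdn : d ∣ n := (dvd_mul_right d d).trans hdd
    have hzd : z ≤ (d : ℝ) := hnr d (Nat.mem_primeFactors.mpr ⟨hdp, hdn, hn0⟩)
    have hmul : d * d * (n / (d * d)) = n := Nat.mul_div_cancel' hdd
    have hm0 : n / (d * d) ≠ 0 := by
      intro h; rw [h, mul_zero] at hmul; exact hn0 hmul.symm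
    have hmdvd : n / (d * d) ∣ n := Nat.div_dvd_of_dvd hdd
    rw [he1, he2]
    refine ⟨hdp, hmul, hzd, ?_, ?_⟩
    · rw [hRof]
      simp only [mem_filter, mem_Icc]
      refine ⟨⟨Nat.one_le_iff_ne_zero.mpr hm0, ?_⟩, rough_of_dvd hn0 hmdvd hnr⟩
      rw [pow_two]
      exact Nat.div_le_div_right hnN
    · rw [hP, mem_filter, mem_Icc]
      refine ⟨⟨Nat.ceil_le.mpr hzd, ?_⟩, hdp⟩
      exact (Nat.le_of_dvd (by omega) hdn).trans hnN
  -- `W/n = G (e n)`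
  have hval : ∀ n ∈ R.filter (fun n => ¬ Squarefree n), W / n = G (e n) := by
    intro n hn
    obtain ⟨-, hmul, -, -, -⟩ := hfacts n hn
    have h' : ((e n).1 : ℝ) * (e n).1 * (e n).2 = n := by exact_mod_cast hmul
    rw [hG]
    simp only
    rw [div_eq_mul_inv, ← h']
    ring
  rw [Finset.sum_congr rfl hval]
  -- injectivity of `e`
  have hinj : Set.InjOn e ↑(R.filter (fun n => ¬ Squarefree n)) := by
    intro n₁ h₁ n₂ h₂ heq
    obtain ⟨-, hm₁, -, -, -⟩ := hfacts n₁ h₁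
    obtain ⟨-, hm₂, -, -, -⟩ := hfacts n₂ h₂
    rw [← hm₁, ← hm₂, heq]
  rw [← Finset.sum_image (f := G) hinj]
  -- the image lies in the sigma set `P.sigma (fun p => Rof (N / p^2))`
  have hsub : (R.filter (fun n => ¬ Squarefree n)).image e ⊆ P.sigma (fun p => Rof (N / p ^ 2)) := by
    intro y hy
    rw [Finset.mem_image] at hy
    obtain ⟨n, hn, hny⟩ := hy
    rw [← hny, Finset.mem_sigma]
    obtain ⟨-, -, -, hm, hp⟩ := hfacts n hn
    exact ⟨hp, hm⟩
  refine (Finset.sum_le_sum_of_subset_of_nonneg hsub fun y _ _ => hG0 y).trans (le_of_eq ?_)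
  rw [Finset.sum_sigma, Finset.mul_sum]
  refine Finset.sum_congr rfl fun p _ => ?_
  rw [Finset.mul_sum, Finset.mul_sum]

end Literature.Barriers.Parity.MatomakiMerikoski
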